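import Literature.Probability.RandomPlanarGeometry.SAWBridgeTwoStepRateZ2
import Literature.Probability.RandomPlanarGeometry.SAWBridgeRenewalLimit
import Literature.Probability.RandomPlanarGeometry.SAWBridgeDivergence
import Literature.Probability.RandomPlanarGeometry.SAWPositiveWalks
import Literature.Probability.RandomPlanarGeometry.BDGS2012CountBoundsProofs
import Literature.Probability.Process.RenewalRatioSandwich
import Mathlib.Analysis.SpecialFunctions.Pow.Real
import HarnessLib

/-!
# The bridge ratio `b_{N+1}/b_N → μ` on `ℤ²` with an explicit rate AND threshold

Topic `Literature/Probability/RandomPlanarGeometry` (continues `SAWBridgeTwoStepRateZ2.lean` and the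
model-free renewal sandwich `Literature/Probability/Process/RenewalRatioSandwich.lean`).

Source: N. Madras, G. Slade, *The Self-Avoiding Walk* (1993), Theorem 7.3.4 (d) (book p. 248; held text
`book:madras1993-self-avoiding-walk` p0261:L12–L20): "(d) `lim_{N→∞} b_{N+1}/b_N = μ`", proved on
pp. 248–249 by a Fatou / lim inf argument on Kesten's renewal equation (4.2.2) — NO RATE is printed
(§7.5, p. 255, prints Kesten's 1963 rates (7.5.1)/(7.5.2) only for `c_N` and `c_N(0,x)`).

## What is new in this file (not in print)

On `ℤ²`, given the two-step upper deviation with an explicit constant and every index,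
`b_{N+2}/b_N - μ² ≤ K·N^{-1/4}` (`N ≥ 1`) — which `SAWBridgeTwoStepRateZ2.lean` derives with
`K = 10 μ √B + 37 B` from Kesten's additive ratio inequality for bridges `KestenIneqBridgesZ2 B` — the
renewal sandwich (`Renewal.ratio_sandwich_sharp`, window `T = ⌊n^{1/8}⌋`, `η = (2K/μ²) n^{-1/4}`) and the
explicit Kesten tail `1 - Σ_{k ≤ m} λ_k μ^{-k} ≤ 1/(1 + ½ log(m/μ))` (`kestenTail_le`, from the conservation
law (B.5) and (3.1.14)) give a rate with CLOSED-FORM constant and CLOSED-FORM threshold: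

* `ratio_rate_explicit_of_twoStep_two`: `|b_n/b_{n-1} - μ| ≤ (64 μ² + 32 K)/log n` for every `n ≥ 3^16`
  with `K^8 ≤ n`;
* `ratio_rate_muOnly_of_twoStep_two`: `|b_n/b_{n-1} - μ| ≤ 66 μ²/log n` once moreover `(8K)^16 ≤ n`
  (the rate constant is free of the pattern constant, which only enters the threshold);
* `bridgeRatio_rate_explicit_Z2` (under `KestenIneqBridgesZ2 B`):
  `|b_{N+1}/b_N - μ| ≤ (64 μ² + 32(10 μ √B + 37 B))/log N` for `N ≥ max(3^16, (10 μ √B + 37 B)^8)`,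
  the numeric packaging `≤ 2720 B/log N` for `N ≥ (67 B)^8` when `B ≥ 1`, and the lane's typed `∃ K N₀` shape
  `exists_bridgeRatio_rate_Z2`.

Elementary inputs: `2 ≤ μ(ℤ²) ≤ 3` (`natCast_le_connectiveConstant`, `connectiveConstant_le`), `λ₁ ≥ 1`.
(Lane «pcv-sawmu», route R16-explicit; the all-`d` `∃ K` rate with the same mechanism is a-p5's
`SAWBridgeRatioRate`; this file is the `ℤ²` closed form.)
-/

noncomputable section

open Finset Filter Topology
open scoped BigOperators

namespace Literature.Probability.RandomPlanarGeometry.SAW.Zd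

/-! ### Small helpers -/

/-- `Σ_{1 ≤ k ≤ n} g k = Σ_{k < n} g (k+1)`. [folklore] -/
private theorem sum_Icc_one_eq_sum_range' (g : ℕ → ℝ) (n : ℕ) :
    ∑ k ∈ Icc 1 n, g k = ∑ k ∈ range n, g (k + 1) := by
  induction n with
  | zero => simp
  | succ n ih => rw [Finset.sum_Icc_succ_top (by omega), ih, Finset.sum_range_succ]

/-- For `y ≥ 2`, `4y + 2 ≤ y^8`. [folklore] -/
private theorem four_mul_add_two_le_pow_eight' {y : ℝ} (hy : 2 ≤ y) : 4 * y + 2 ≤ y ^ 8 := by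
  have h7 : (2 : ℝ) ^ 7 ≤ y ^ 7 := pow_le_pow_left₀ (by norm_num) hy 7
  have hy0 : 0 ≤ y := by linarith
  have : y ^ 8 = y * y ^ 7 := by ring
  nlinarith

/-- `2 ≤ μ(ℤ²) ≤ 3`. [cite: MadrasSlade1993, §1.2, eqs. (1.2.2), (1.2.10)] -/
private theorem two_le_mu_two_le_three : (2 : ℝ) ≤ connectiveConstant 2 ∧ connectiveConstant 2 ≤ 3 := by
  refine ⟨by exact_mod_cast natCast_le_connectiveConstant 2, ?_⟩
  have := connectiveConstant_le 2 (by norm_num); norm_num at this; exact this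

/-! ### The explicit Kesten tail -/

/-- **The explicit Kesten tail** (every `d ≥ 1`): `1 - Σ_{1 ≤ k ≤ m} λ_k μ^{-k} ≤ 1/(1 + ½ log(m/μ))` for
`m ≥ 1` with `μ ≤ m`. Proof: the conservation law (B.5) `Σ_{k ≤ m} T_k u_{m-k} = 1` (`u_n = b_n μ^{-n}`,
`T_k = 1 - Σ_{j ≤ k} λ_j μ^{-j}` antitone) gives `T_m · Σ_{n ≤ m} u_n ≤ 1`, and
`Σ_{n ≤ m} u_n = 1 + B⁺_m(1/μ) ≥ 1 + ½ log(m/μ)` by (3.1.14) (`half_log_le_sum_bridgeCount`).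
(Adapted from a-p5's lane file `R16_BridgeRatioRate.lean`, same proof.)
[cite: MadrasSlade1993, eq. (4.2.4) with Appendix B (B.5) and eq. (3.1.14) (quantitative form)] -/
theorem kestenTail_le (d : ℕ) [NeZero d] {m : ℕ} (hm : 1 ≤ m) (hμm : connectiveConstant d ≤ m) :
    1 - ∑ k ∈ Icc 1 m, (irreducibleBridgeCount d k : ℝ) / connectiveConstant d ^ k ≤
      1 / (1 + Real.log ((m : ℝ) / connectiveConstant d) / 2) := by
  obtain ⟨m', rfl⟩ : ∃ m', m = m' + 1 := ⟨m - 1, by omega⟩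
  set μ := connectiveConstant d with hμdef
  have hμ : 0 < μ := connectiveConstant_pos d
  set u : ℕ → ℝ := fun n => (bridgeCount d n : ℝ) / μ ^ n with hu
  set f : ℕ → ℝ := fun k => (irreducibleBridgeCount d k : ℝ) / μ ^ k with hf
  set r : ℕ → ℝ := fun n => 1 - ∑ k ∈ range (n + 1), f k with hrdef
  have hr : ∀ n, r n = 1 - ∑ k ∈ range (n + 1), f k := fun n => rfl
  have hu0 : u 0 = 1 := bridgeCount_div_pow_zero d
  have hf0 : f 0 = 0 := irreducibleBridgeCount_div_pow_zero d
  have hren : ∀ n, 1 ≤ n → u n = ∑ k ∈ range (n + 1), f k * u (n - k) :=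
    fun n hn => MadrasSlade1993_eq425 d hn
  have hB5 := _root_.Literature.Probability.Process.Renewal.sum_tailSum_mul_eq_one hr hu0 hf0 hren (m' + 1)
  have hf_nonneg : ∀ k, 0 ≤ f k := irreducibleBridgeCount_div_pow_nonneg d
  have hr_anti : Antitone r := by
    refine antitone_nat_of_succ_le fun n => ?_
    rw [_root_.Literature.Probability.Process.Renewal.tailSum_succ hr n]
    linarith [hf_nonneg (n + 1)]
  have hu_nonneg : ∀ n, 0 ≤ u n := bridgeCount_div_pow_nonneg d
  have h1 : r (m' + 1) * ∑ k ∈ range (m' + 1 + 1), u (m' + 1 - k) ≤ 1 := by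
    rw [← hB5, Finset.mul_sum]
    refine Finset.sum_le_sum fun k hk => ?_
    have hk' : k ≤ m' + 1 := Nat.lt_succ_iff.1 (Finset.mem_range.1 hk)
    exact mul_le_mul_of_nonneg_right (hr_anti hk') (hu_nonneg _)
  have h2 : ∑ k ∈ range (m' + 1 + 1), u (m' + 1 - k) = 1 + bridgeGFpos d (m' + 1) μ⁻¹ := by
    have hrefl : ∑ k ∈ range (m' + 1 + 1), u (m' + 1 - k) = ∑ k ∈ range (m' + 1 + 1), u k := by
      have := Finset.sum_range_reflect u (m' + 1 + 1)
      simpa using this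
    rw [hrefl, bridgeGFpos, Finset.sum_range_succ',
      Finset.sum_range_succ' (fun n => if n = 0 then (0 : ℝ) else (bridgeCount d n : ℝ) * μ⁻¹ ^ n)]
    simp only [Nat.succ_ne_zero, if_false, if_true, hu0, add_zero]
    rw [add_comm]
    congr 1
    refine Finset.sum_congr rfl fun n _ => ?_
    simp only [hu, inv_pow, div_eq_mul_inv]
  have hlog0 : 0 ≤ Real.log (((m' + 1 : ℕ) : ℝ) / μ) := by
    refine Real.log_nonneg ?_
    rw [le_div_iff₀ hμ, one_mul]; exact hμm
  have hm1 : ((m' + 1 : ℕ) : ℝ) = (m' : ℝ) + 1 := by push_cast; ring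
  rw [hm1] at hlog0 ⊢
  have hU : 1 + Real.log (((m' : ℝ) + 1) / μ) / 2 ≤ ∑ k ∈ range (m' + 1 + 1), u (m' + 1 - k) := by
    rw [h2]
    have h3 : Real.log ((m' + 1 : ℝ) / μ) / 2 ≤ bridgeGFpos d (m' + 1) μ⁻¹ :=
      half_log_le_sum_bridgeCount (d := d) m'
    linarith
  have hUpos : 0 < 1 + Real.log (((m' : ℝ) + 1) / μ) / 2 := by linarith
  have hrm : r (m' + 1) = 1 - ∑ k ∈ Icc 1 (m' + 1), f k := by
    rw [hr, Finset.sum_range_succ', hf0, add_zero, sum_Icc_one_eq_sum_range']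
  rw [← hrm, le_div_iff₀ hUpos]
  have hrlast : 0 ≤ r (m' + 1) := by
    rw [hr]
    have := sum_irreducibleBridgeCount_div_pow_le_one d (range (m' + 1 + 1))
    linarith
  calc r (m' + 1) * (1 + Real.log (((m' : ℝ) + 1) / μ) / 2)
      ≤ r (m' + 1) * ∑ k ∈ range (m' + 1 + 1), u (m' + 1 - k) :=
        mul_le_mul_of_nonneg_left hU hrlast
    _ ≤ 1 := h1

/-! ### The explicit composition on `ℤ²`: small pieces -/

/-- `((n^{1/8})^8 = n`. [folklore] -/
private theorem rpow_eighth_pow (n : ℕ) : ((n : ℝ) ^ ((1 : ℝ) / 8)) ^ 8 = (n : ℝ) := by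
  rw [show ((1 : ℝ) / 8) = ((8 : ℕ) : ℝ)⁻¹ by norm_num]
  exact Real.rpow_inv_natCast_pow (Nat.cast_nonneg n) (by norm_num)

/-- `(x^8)^{1/8} = x` for `x ≥ 0`. [folklore] -/
private theorem pow_rpow_eighth {x : ℝ} (hx : 0 ≤ x) : (x ^ 8) ^ ((1 : ℝ) / 8) = x := by
  rw [show ((1 : ℝ) / 8) = ((8 : ℕ) : ℝ)⁻¹ by norm_num]
  exact Real.pow_rpow_inv_natCast hx (by norm_num)

/-- `x^8 ≤ n` gives `x ≤ n^{1/8}` (`x ≥ 0`). [folklore] -/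
private theorem le_rpow_eighth {x : ℝ} (hx : 0 ≤ x) {n : ℕ} (h : x ^ 8 ≤ (n : ℝ)) :
    x ≤ (n : ℝ) ^ ((1 : ℝ) / 8) := by
  rw [← pow_rpow_eighth hx]
  exact Real.rpow_le_rpow (by positivity) h (by norm_num)

/-- `9 ≤ n^{1/8}` for `n ≥ 3^16 = 9^8`. [folklore] -/
private theorem nine_le_rpow_eighth {n : ℕ} (hn : 3 ^ 16 ≤ n) : 9 ≤ (n : ℝ) ^ ((1 : ℝ) / 8) := by
  refine le_rpow_eighth (by norm_num) ?_
  have h : ((3 ^ 16 : ℕ) : ℝ) ≤ (n : ℝ) := by exact_mod_cast hn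
  have h9 : ((9 : ℝ) ^ 8) = ((3 ^ 16 : ℕ) : ℝ) := by norm_num
  rw [h9]; exact h

/-- `n^{-1/4} = ((n^{1/8})^2)⁻¹`. [folklore] -/
private theorem rpow_neg_quarter (n : ℕ) :
    (n : ℝ) ^ (-(1 : ℝ) / 4) = (((n : ℝ) ^ ((1 : ℝ) / 8)) ^ 2)⁻¹ := by
  rw [show (-(1 : ℝ) / 4) = ((1 : ℝ) / 8) * (-2) by norm_num, Real.rpow_mul (Nat.cast_nonneg n),
    Real.rpow_neg (Real.rpow_nonneg (Nat.cast_nonneg n) _), Real.rpow_two]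

/-- `M^{-1/4} ≤ 2 n^{-1/4}` for `1 ≤ M`, `n ≤ 2M`. [folklore] -/
private theorem rpow_neg_quarter_window {n M : ℕ} (hn : 1 ≤ n) (hM0 : 1 ≤ M) (h2M : n ≤ 2 * M) :
    (M : ℝ) ^ (-(1 : ℝ) / 4) ≤ 2 * (n : ℝ) ^ (-(1 : ℝ) / 4) := by
  have hn0 : (0 : ℝ) ≤ n := Nat.cast_nonneg n
  have hM : (0 : ℝ) < M := by exact_mod_cast (show 0 < M by omega)
  have hMr : (n : ℝ) / 2 ≤ M := by
    have : (n : ℝ) ≤ 2 * M := by exact_mod_cast h2M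
    linarith
  have hn0' : (0 : ℝ) < n := by exact_mod_cast (show 0 < n by omega)
  have h1 : (M : ℝ) ^ (-(1 : ℝ) / 4) ≤ ((n : ℝ) / 2) ^ (-(1 : ℝ) / 4) :=
    Real.rpow_le_rpow_of_nonpos (by positivity) hMr (by norm_num)
  have h2 : ((n : ℝ) / 2) ^ (-(1 : ℝ) / 4) = (n : ℝ) ^ (-(1 : ℝ) / 4) / (2 : ℝ) ^ (-(1 : ℝ) / 4) :=
    Real.div_rpow hn0 (by norm_num) _
  have h3 : (1 / 2 : ℝ) ≤ (2 : ℝ) ^ (-(1 : ℝ) / 4) := by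
    rw [show (-(1 : ℝ) / 4) = -((1 : ℝ) / 4) by ring, Real.rpow_neg (by norm_num), one_div]
    refine inv_anti₀ (by positivity) ?_
    calc (2 : ℝ) ^ ((1 : ℝ) / 4) ≤ (2 : ℝ) ^ (1 : ℝ) :=
          Real.rpow_le_rpow_of_exponent_le (by norm_num) (by norm_num)
      _ = 2 := Real.rpow_one 2
  have h4 : 0 ≤ (n : ℝ) ^ (-(1 : ℝ) / 4) := Real.rpow_nonneg hn0 _
  calc (M : ℝ) ^ (-(1 : ℝ) / 4) ≤ (n : ℝ) ^ (-(1 : ℝ) / 4) / (2 : ℝ) ^ (-(1 : ℝ) / 4) := by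
        rw [← h2]; exact h1
    _ ≤ (n : ℝ) ^ (-(1 : ℝ) / 4) / (1 / 2) := div_le_div_of_nonneg_left h4 (by norm_num) h3
    _ = 2 * (n : ℝ) ^ (-(1 : ℝ) / 4) := by ring

/-- Window control from the all-`N` two-step upper rate (`K ≥ 0`): for `M ≥ 1` with `n ≤ 2M` (`n ≥ 1`),
`b_{M+2} μ^{-(M+2)} ≤ (1 + (2K/μ²) n^{-1/4}) · b_M μ^{-M}`.
[cite: MadrasSlade1993, Theorem 7.3.4 (d) (proof, window step; quantitative form)] -/
private theorem window_control_two {K : ℝ} (hK : 0 ≤ K)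
    (hU : ∀ N : ℕ, 1 ≤ N →
      (bridgeCount 2 (N + 2) : ℝ) / bridgeCount 2 N - connectiveConstant 2 ^ 2 ≤ K * (N : ℝ) ^ (-(1 : ℝ) / 4))
    {n M : ℕ} (hn : 1 ≤ n) (hM0 : 1 ≤ M) (h2M : n ≤ 2 * M) :
    (bridgeCount 2 (M + 2) : ℝ) / connectiveConstant 2 ^ (M + 2) ≤
      (1 + 2 * (K / connectiveConstant 2 ^ 2) * (n : ℝ) ^ (-(1 : ℝ) / 4)) *
        ((bridgeCount 2 M : ℝ) / connectiveConstant 2 ^ M) := by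
  set μ := connectiveConstant 2 with hμdef
  have hμ : 0 < μ := connectiveConstant_pos 2
  have hbM : (0 : ℝ) < bridgeCount 2 M := by exact_mod_cast one_le_bridgeCount (d := 2) M
  have hpow := rpow_neg_quarter_window hn hM0 h2M
  set η : ℝ := 2 * (K / μ ^ 2) * (n : ℝ) ^ (-(1 : ℝ) / 4) with hηdef
  have hrat : (bridgeCount 2 (M + 2) : ℝ) / bridgeCount 2 M ≤ μ ^ 2 * (1 + η) := by
    have h1 := hU M hM0
    have h2 : K * (M : ℝ) ^ (-(1 : ℝ) / 4) ≤ K * (2 * (n : ℝ) ^ (-(1 : ℝ) / 4)) :=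
      mul_le_mul_of_nonneg_left hpow hK
    have h3 : μ ^ 2 * (1 + η) = μ ^ 2 + K * (2 * (n : ℝ) ^ (-(1 : ℝ) / 4)) := by
      rw [hηdef]; field_simp
    rw [h3]; linarith
  have hb2 : (bridgeCount 2 (M + 2) : ℝ) ≤ μ ^ 2 * (1 + η) * bridgeCount 2 M := by
    rwa [div_le_iff₀ hbM] at hrat
  rw [div_le_iff₀ (pow_pos hμ _), pow_add,
    show (1 + η) * ((bridgeCount 2 M : ℝ) / μ ^ M) * (μ ^ M * μ ^ 2) =
      μ ^ 2 * (1 + η) * bridgeCount 2 M by field_simp]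
  exact hb2

/-- Dropped Kesten mass in the window: if `μ² ≤ n^{1/8} ≤ 2T` (`n ≥ 2`) then
`1 - Σ_{k ≤ 2T} λ_k μ^{-k} ≤ 32/log n` (`log(2T/μ) ≥ log n^{1/8} - ½ log n^{1/8} = log n / 16`).
[cite: MadrasSlade1993, eq. (4.2.4) (quantitative tail, derived)] -/
private theorem dropped_mass_two {n T : ℕ} (hn : 2 ≤ n) (hT : 1 ≤ T)
    (hyT : (n : ℝ) ^ ((1 : ℝ) / 8) ≤ ((2 * T : ℕ) : ℝ))
    (hyμ : connectiveConstant 2 ^ 2 ≤ (n : ℝ) ^ ((1 : ℝ) / 8)) :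
    1 - ∑ k ∈ Icc 1 (2 * T), (irreducibleBridgeCount 2 k : ℝ) / connectiveConstant 2 ^ k ≤
      32 / Real.log n := by
  set μ := connectiveConstant 2 with hμdef
  have hμ : 0 < μ := connectiveConstant_pos 2
  have hμ1 : 1 ≤ μ := one_le_connectiveConstant 2
  have hn0 : (0 : ℝ) < n := by exact_mod_cast (show 0 < n by omega)
  have hlogn : 0 < Real.log n := Real.log_pos (by exact_mod_cast (show 1 < n by omega))
  set y : ℝ := (n : ℝ) ^ ((1 : ℝ) / 8) with hydef
  have hy1 : 1 ≤ y := le_trans (by nlinarith) hyμ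
  have hy0 : 0 < y := by linarith
  have h2T1 : 1 ≤ 2 * T := by omega
  have hμ2T : μ ≤ (2 * T : ℕ) := by nlinarith
  have hε1 := kestenTail_le 2 h2T1 hμ2T
  have hL : Real.log n / 16 ≤ Real.log (((2 * T : ℕ) : ℝ) / μ) := by
    have h1 : Real.log (y / μ) ≤ Real.log (((2 * T : ℕ) : ℝ) / μ) :=
      Real.log_le_log (by positivity) (div_le_div_of_nonneg_right hyT hμ.le)
    have h2 : Real.log (y / μ) = Real.log y - Real.log μ := Real.log_div hy0.ne' hμ.ne'
    have h3 : Real.log y = (1 : ℝ) / 8 * Real.log n := by rw [hydef, Real.log_rpow hn0]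
    have h4 : 2 * Real.log μ ≤ Real.log y := by
      have : Real.log (μ ^ 2) = 2 * Real.log μ := by rw [Real.log_pow]; norm_num
      rw [← this]; exact Real.log_le_log (by positivity) hyμ
    linarith
  refine hε1.trans ?_
  calc 1 / (1 + Real.log (((2 * T : ℕ) : ℝ) / μ) / 2)
      ≤ 1 / (Real.log (((2 * T : ℕ) : ℝ) / μ) / 2) :=
        one_div_le_one_div_of_le (by linarith) (by linarith)
    _ ≤ 1 / (Real.log n / 32) := one_div_le_one_div_of_le (by positivity) (by linarith)
    _ = 32 / Real.log n := by rw [one_div_div]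

/-- `b_n/b_{n-1} - μ = μ · (a_n/a_{n-1} - 1)` with `a_k = b_k μ^{-k}` (`n ≥ 1`). [folklore] -/
private theorem ratio_conv_two {n : ℕ} (hn : 1 ≤ n) :
    (bridgeCount 2 n : ℝ) / bridgeCount 2 (n - 1) - connectiveConstant 2 =
      connectiveConstant 2 *
        (((bridgeCount 2 n : ℝ) / connectiveConstant 2 ^ n) /
            ((bridgeCount 2 (n - 1) : ℝ) / connectiveConstant 2 ^ (n - 1)) - 1) := by
  set μ := connectiveConstant 2 with hμdef
  have hμ : 0 < μ := connectiveConstant_pos 2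
  obtain ⟨n', rfl⟩ : ∃ n', n = n' + 1 := ⟨n - 1, by omega⟩
  have hb0 : (0 : ℝ) < bridgeCount 2 n' := by exact_mod_cast one_le_bridgeCount (d := 2) n'
  rw [Nat.add_sub_cancel, pow_succ]
  field_simp

/-- Core of the explicit rate on `ℤ²`: from `b_{N+2}/b_N - μ² ≤ K N^{-1/4}` (all `N ≥ 1`, `K ≥ 0`), for
every `n ≥ 3^16` with `K^8 ≤ n`,
`|b_n/b_{n-1} - μ| ≤ 2μ² (32/log n + 2K/(μ² n^{1/8}))`
(window `T = ⌊n^{1/8}⌋`, `η = (2K/μ²) n^{-1/4}`, dropped Kesten mass `≤ 32/log n`, `E_o ≥ λ₁/μ ≥ 1/μ`,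
`1 - Tη ≥ 1/2`). [cite: MadrasSlade1993, Theorem 7.3.4 (d) (quantitative form, derived)] -/
private theorem ratio_rate_core_two {K : ℝ} (hK : 0 ≤ K)
    (hU : ∀ N : ℕ, 1 ≤ N →
      (bridgeCount 2 (N + 2) : ℝ) / bridgeCount 2 N - connectiveConstant 2 ^ 2 ≤ K * (N : ℝ) ^ (-(1 : ℝ) / 4))
    {n : ℕ} (hn : 3 ^ 16 ≤ n) (hKn : K ^ 8 ≤ (n : ℝ)) :
    |(bridgeCount 2 n : ℝ) / bridgeCount 2 (n - 1) - connectiveConstant 2| ≤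
      2 * connectiveConstant 2 ^ 2 *
        (32 / Real.log n + 2 * K / (connectiveConstant 2 ^ 2 * (n : ℝ) ^ ((1 : ℝ) / 8))) := by
  set μ := connectiveConstant 2 with hμdef
  obtain ⟨hμ2, hμ3⟩ := two_le_mu_two_le_three
  have hμ : 0 < μ := by linarith
  have hμsq : 4 ≤ μ ^ 2 := by nlinarith
  -- the parameter `y = n^{1/8}`
  set y : ℝ := (n : ℝ) ^ ((1 : ℝ) / 8) with hydef
  have hn_eq : (n : ℝ) = y ^ 8 := (rpow_eighth_pow n).symm
  have hy9 : 9 ≤ y := nine_le_rpow_eighth hn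
  have hy2 : 2 ≤ y := by linarith
  have hy0 : 0 < y := by linarith
  have hKy : K ≤ y := le_rpow_eighth hK hKn
  have hyμ : μ ^ 2 ≤ y := by nlinarith
  have hn2 : 2 ≤ n := le_trans (by norm_num) hn
  have hn1 : 1 ≤ n := by omega
  have hlogn : 0 < Real.log n := Real.log_pos (by exact_mod_cast (show 1 < n by omega))
  -- `T = ⌊y⌋`
  set T : ℕ := ⌊y⌋₊ with hTdef
  have hT1 : 1 ≤ T := (Nat.one_le_floor_iff y).2 (by linarith)
  have hTy : (T : ℝ) ≤ y := Nat.floor_le hy0.le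
  have hyT : y < T + 1 := Nat.lt_floor_add_one y
  have hwinR : (2 * (2 * T + 1) : ℝ) ≤ n := by
    rw [hn_eq]; have := four_mul_add_two_le_pow_eight' hy2; linarith
  have hwin : 2 * (2 * T + 1) ≤ n := by exact_mod_cast hwinR
  have hT : 2 * T + 1 ≤ n := by omega
  -- `η = (2K/μ²) n^{-1/4} = 2K/(μ² y²)` and `Tη ≤ τ₀ = 2K/(μ² y) ≤ 1/2`
  set η : ℝ := 2 * (K / μ ^ 2) * (n : ℝ) ^ (-(1 : ℝ) / 4) with hηdef
  have hnq : (n : ℝ) ^ (-(1 : ℝ) / 4) = (y ^ 2)⁻¹ := by rw [hydef]; exact rpow_neg_quarter n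
  have hKμ0 : 0 ≤ K / μ ^ 2 := by positivity
  have hη0 : 0 ≤ η := by
    rw [hηdef]; exact mul_nonneg (by linarith) (Real.rpow_nonneg (Nat.cast_nonneg n) _)
  have hηy : η = 2 * (K / μ ^ 2) / y ^ 2 := by rw [hηdef, hnq]; ring
  set τ₀ : ℝ := 2 * K / (μ ^ 2 * y) with hτ₀
  have hTη' : (T : ℝ) * η ≤ τ₀ := by
    have h1 : (T : ℝ) * η ≤ y * η := mul_le_mul_of_nonneg_right hTy hη0
    have h2 : y * η = τ₀ := by rw [hηy, hτ₀]; field_simp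
    linarith
  have hτ₀half : τ₀ ≤ 1 / 2 := by
    rw [hτ₀, div_le_iff₀ (by positivity)]
    nlinarith
  have hTη : (T : ℝ) * η ≤ 1 / 2 := hTη'.trans hτ₀half
  -- the renewal data on `ℤ²`
  set a : ℕ → ℝ := fun k => (bridgeCount 2 k : ℝ) / μ ^ k with hadef
  set p : ℕ → ℝ := fun k => (irreducibleBridgeCount 2 k : ℝ) / μ ^ k with hpdef
  have ha_pos : ∀ k, 0 < a k := fun k => by
    have hb : (1 : ℝ) ≤ bridgeCount 2 k := by exact_mod_cast one_le_bridgeCount (d := 2) k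
    simp only [hadef]; positivity
  have hp0 : ∀ k, 0 ≤ p k := fun k => by simp only [hpdef]; positivity
  have hp1' : μ⁻¹ ≤ p 1 := by
    have h1 : (1 : ℝ) ≤ irreducibleBridgeCount 2 1 := by
      exact_mod_cast one_le_irreducibleBridgeCount_one (d := 2)
    simp only [hpdef, pow_one]
    rw [inv_eq_one_div]
    exact div_le_div_of_nonneg_right h1 hμ.le
  have hp1 : 0 < p 1 := lt_of_lt_of_le (inv_pos.2 hμ) hp1'
  have hsum : ∑ k ∈ Icc 1 (2 * T + 1), p k ≤ 1 :=
    sum_irreducibleBridgeCount_div_pow_le_one 2 _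
  have hren : ∀ k, 1 ≤ k → a k = ∑ j ∈ Icc 1 k, p j * a (k - j) := by
    intro k hk
    have h := MadrasSlade1993_eq425 2 hk
    rw [Finset.sum_range_succ'] at h
    have h0 : (irreducibleBridgeCount 2 0 : ℝ) / μ ^ 0 = 0 := irreducibleBridgeCount_div_pow_zero 2
    rw [h0, zero_mul, add_zero] at h
    simp only [hadef, hpdef]
    rw [h, sum_Icc_one_eq_sum_range']
  have hup : ∀ M, n - (2 * T + 1) ≤ M → M + 2 ≤ n → a (M + 2) ≤ (1 + η) * a M := by
    intro M hM1 hM2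
    simp only [hadef]
    exact window_control_two hK hU hn1 (by omega) (by omega)
  -- the sharp sandwich
  have hS := _root_.Literature.Probability.Process.Renewal.ratio_sandwich_sharp a p n T η hT1 hT hη0 hTη
    (fun k => (ha_pos k).le) hp0 (ha_pos n) (ha_pos (n - 1)) hp1 hsum hren hup
  -- `E_o ≥ 1/μ`
  have hEo : μ⁻¹ ≤ ∑ t ∈ range T, p (2 * t + 1) := by
    have h1 : p (2 * 0 + 1) ≤ ∑ t ∈ range T, p (2 * t + 1) :=
      Finset.single_le_sum (f := fun t => p (2 * t + 1)) (fun t _ => hp0 _)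
        (Finset.mem_range.2 (by omega))
    exact le_trans hp1' (by simpa using h1)
  -- dropped mass `ε ≤ 32/log n`
  have hy2T : y ≤ (2 * T : ℕ) := by push_cast; linarith
  have hε : 1 - ∑ k ∈ Icc 1 (2 * T), p k ≤ 32 / Real.log n := by
    simp only [hpdef]
    exact dropped_mass_two hn2 hT1 hy2T hyμ
  -- assemble `|a_n/a_{n-1} - 1| ≤ 2μ (32/log n + τ₀)`
  have hε0 : 0 ≤ 1 - ∑ k ∈ Icc 1 (2 * T), p k := by
    have := sum_irreducibleBridgeCount_div_pow_le_one 2 (Icc 1 (2 * T))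
    simp only [hpdef]; linarith
  have hTη0 : 0 ≤ (T : ℝ) * η := mul_nonneg (Nat.cast_nonneg T) hη0
  have hnum0 : 0 ≤ (1 - ∑ k ∈ Icc 1 (2 * T), p k) + T * η := by linarith
  have hnum : (1 - ∑ k ∈ Icc 1 (2 * T), p k) + T * η ≤ 32 / Real.log n + τ₀ := by linarith
  have hden : μ⁻¹ / 2 ≤ (1 - T * η) * ∑ t ∈ range T, p (2 * t + 1) := by
    have h1 : (1 : ℝ) / 2 ≤ 1 - T * η := by linarith
    have h2 : (0 : ℝ) ≤ 1 - T * η := by linarith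
    calc μ⁻¹ / 2 = (1 / 2) * μ⁻¹ := by ring
      _ ≤ (1 - T * η) * ∑ t ∈ range T, p (2 * t + 1) := mul_le_mul h1 hEo (inv_pos.2 hμ).le h2
  have hden_pos : 0 < μ⁻¹ / 2 := by positivity
  have hA : |a n / a (n - 1) - 1| ≤ 2 * μ * (32 / Real.log n + τ₀) := by
    refine hS.trans ?_
    calc ((1 - ∑ k ∈ Icc 1 (2 * T), p k) + T * η) / ((1 - T * η) * ∑ t ∈ range T, p (2 * t + 1))
        ≤ ((1 - ∑ k ∈ Icc 1 (2 * T), p k) + T * η) / (μ⁻¹ / 2) :=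
          div_le_div_of_nonneg_left hnum0 hden_pos hden
      _ ≤ (32 / Real.log n + τ₀) / (μ⁻¹ / 2) := div_le_div_of_nonneg_right hnum hden_pos.le
      _ = 2 * μ * (32 / Real.log n + τ₀) := by
          rw [div_div_eq_mul_div, div_inv_eq_mul]; ring
  -- convert to `b_n / b_{n-1}`
  have hconv : (bridgeCount 2 n : ℝ) / bridgeCount 2 (n - 1) - μ = μ * (a n / a (n - 1) - 1) := by
    simp only [hadef]; exact ratio_conv_two hn1
  rw [hconv, abs_mul, abs_of_pos hμ]
  calc μ * |a n / a (n - 1) - 1| ≤ μ * (2 * μ * (32 / Real.log n + τ₀)) :=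
        mul_le_mul_of_nonneg_left hA hμ.le
    _ = 2 * μ ^ 2 * (32 / Real.log n + 2 * K / (μ ^ 2 * y)) := by rw [hτ₀]; ring

/-- **Explicit rate and threshold for Theorem 7.3.4 (d) on `ℤ²`, from an all-`N` two-step upper rate.**
If `b_{N+2}/b_N - μ² ≤ K·N^{-1/4}` for every `N ≥ 1` (`K ≥ 0`), then for every `n ≥ 3^16` with `K^8 ≤ n`:
`|b_n/b_{n-1} - μ| ≤ (64 μ² + 32 K)/log n`.
[cite: MadrasSlade1993, Theorem 7.3.4 (d) (quantitative form, derived)] -/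
theorem ratio_rate_explicit_of_twoStep_two {K : ℝ} (hK : 0 ≤ K)
    (hU : ∀ N : ℕ, 1 ≤ N →
      (bridgeCount 2 (N + 2) : ℝ) / bridgeCount 2 N - connectiveConstant 2 ^ 2 ≤ K * (N : ℝ) ^ (-(1 : ℝ) / 4))
    {n : ℕ} (hn : 3 ^ 16 ≤ n) (hKn : K ^ 8 ≤ (n : ℝ)) :
    |(bridgeCount 2 n : ℝ) / bridgeCount 2 (n - 1) - connectiveConstant 2| ≤
      (64 * connectiveConstant 2 ^ 2 + 32 * K) / Real.log n := by
  have hcore := ratio_rate_core_two hK hU hn hKn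
  set μ := connectiveConstant 2 with hμdef
  obtain ⟨hμ2, hμ3⟩ := two_le_mu_two_le_three
  have hμ : 0 < μ := by linarith
  have hn2 : 2 ≤ n := le_trans (by norm_num) hn
  have hn0 : (0 : ℝ) < n := by exact_mod_cast (show 0 < n by omega)
  have hlogn : 0 < Real.log n := Real.log_pos (by exact_mod_cast (show 1 < n by omega))
  set y : ℝ := (n : ℝ) ^ ((1 : ℝ) / 8) with hydef
  have hy0 : 0 < y := Real.rpow_pos_of_pos hn0 _
  -- `log n ≤ 8 y`, so `2K/(μ² y) ≤ 16 K/(μ² log n)`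
  have hlog8 : Real.log n ≤ 8 * y := by
    have := Real.log_le_rpow_div hn0.le (by norm_num : (0 : ℝ) < 1 / 8)
    rw [← hydef] at this; linarith
  have hτ : 2 * K / (μ ^ 2 * y) ≤ 16 * K / (μ ^ 2 * Real.log n) := by
    rw [div_le_div_iff₀ (by positivity) (by positivity)]
    have : 2 * K * (μ ^ 2 * Real.log n) ≤ 2 * K * (μ ^ 2 * (8 * y)) := by gcongr
    linarith
  refine hcore.trans ?_
  calc 2 * μ ^ 2 * (32 / Real.log n + 2 * K / (μ ^ 2 * y))
      ≤ 2 * μ ^ 2 * (32 / Real.log n + 16 * K / (μ ^ 2 * Real.log n)) := by gcongr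
    _ = (64 * μ ^ 2 + 32 * K) / Real.log n := by field_simp; ring

/-- **The pattern constant only enters the threshold.** Under the same all-`N` two-step upper rate with
constant `K ≥ 0`: for every `n ≥ 3^16` with `(8K)^16 ≤ n`, `|b_n/b_{n-1} - μ| ≤ 66 μ²/log n`
(`Tη ≤ 2K/(μ² n^{1/8}) ≤ 1/log n` there, since `log n^{1/8} ≤ 2 n^{1/16}`).
[cite: MadrasSlade1993, Theorem 7.3.4 (d) (quantitative form, derived)] -/
theorem ratio_rate_muOnly_of_twoStep_two {K : ℝ} (hK : 0 ≤ K)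
    (hU : ∀ N : ℕ, 1 ≤ N →
      (bridgeCount 2 (N + 2) : ℝ) / bridgeCount 2 N - connectiveConstant 2 ^ 2 ≤ K * (N : ℝ) ^ (-(1 : ℝ) / 4))
    {n : ℕ} (hn : 3 ^ 16 ≤ n) (hKn : (8 * K) ^ 16 ≤ (n : ℝ)) :
    |(bridgeCount 2 n : ℝ) / bridgeCount 2 (n - 1) - connectiveConstant 2| ≤
      66 * connectiveConstant 2 ^ 2 / Real.log n := by
  set μ := connectiveConstant 2 with hμdef
  obtain ⟨hμ2, hμ3⟩ := two_le_mu_two_le_three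
  have hμ : 0 < μ := by linarith
  have hμsq : 4 ≤ μ ^ 2 := by nlinarith
  have hn2 : 2 ≤ n := le_trans (by norm_num) hn
  have hn0 : (0 : ℝ) < n := by exact_mod_cast (show 0 < n by omega)
  have hn1 : (1 : ℝ) ≤ n := by exact_mod_cast (show 1 ≤ n by omega)
  have hlogn : 0 < Real.log n := Real.log_pos (by exact_mod_cast (show 1 < n by omega))
  set y : ℝ := (n : ℝ) ^ ((1 : ℝ) / 8) with hydef
  have hy0 : 0 < y := Real.rpow_pos_of_pos hn0 _
  have hy1 : 1 ≤ y := Real.one_le_rpow hn1 (by norm_num)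
  have h18 : ((1 : ℝ) / 8) = ((8 : ℕ) : ℝ)⁻¹ := by norm_num
  have hn_eq : (n : ℝ) = y ^ 8 := by
    rw [hydef, h18, Real.rpow_inv_natCast_pow hn0.le (by norm_num)]
  -- `K^8 ≤ (8K)^16 ≤ n` (if `K ≥ 1/8`; else `K^8 ≤ 1 ≤ n`)
  have hK8 : K ^ 8 ≤ (n : ℝ) := by
    by_cases h : 1 ≤ 8 * K
    · calc K ^ 8 ≤ (8 * K) ^ 8 := pow_le_pow_left₀ hK (by linarith) 8
        _ ≤ (8 * K) ^ 16 := pow_le_pow_right₀ h (by norm_num)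
        _ ≤ n := hKn
    · have h' : 8 * K < 1 := lt_of_not_ge h
      calc K ^ 8 ≤ 1 ^ 8 := pow_le_pow_left₀ hK (by linarith) 8
        _ = 1 := one_pow 8
        _ ≤ n := hn1
  have hcore := ratio_rate_core_two hK hU hn hK8
  -- `(8K)^2 ≤ y` from `(8K)^16 ≤ y^8`
  have h8Ky : (8 * K) ^ 2 ≤ y := by
    have h1 : ((8 * K) ^ 2) ^ 8 ≤ y ^ 8 := by rw [← pow_mul, ← hn_eq]; exact hKn
    exact le_of_pow_le_pow_left₀ (by norm_num) hy0.le h1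
  -- `log y ≤ 2 √y` and `8K √y ≤ y`, hence `16 K log y ≤ 4 y ≤ μ² y`
  have hsqrt : Real.log y ≤ 2 * Real.sqrt y := by
    have := Real.log_le_rpow_div hy0.le (by norm_num : (0 : ℝ) < 1 / 2)
    rw [← Real.sqrt_eq_rpow] at this; linarith
  have hsy : 0 ≤ Real.sqrt y := Real.sqrt_nonneg y
  have h8K : 8 * K ≤ Real.sqrt y := by
    rw [show 8 * K = Real.sqrt ((8 * K) ^ 2) by rw [Real.sqrt_sq (by positivity)]]
    exact Real.sqrt_le_sqrt h8Ky
  have hKlogy : 16 * K * Real.log y ≤ μ ^ 2 * y := by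
    have h1 : 16 * K * Real.log y ≤ 16 * K * (2 * Real.sqrt y) :=
      mul_le_mul_of_nonneg_left hsqrt (by positivity)
    have h2 : 16 * K * (2 * Real.sqrt y) = 4 * (8 * K) * Real.sqrt y := by ring
    have h3 : 4 * (8 * K) * Real.sqrt y ≤ 4 * Real.sqrt y * Real.sqrt y := by nlinarith
    have h4 : Real.sqrt y * Real.sqrt y = y := Real.mul_self_sqrt hy0.le
    nlinarith
  have hlogy : Real.log n = 8 * Real.log y := by
    rw [hn_eq, Real.log_pow]; norm_num
  have hτ : 2 * K / (μ ^ 2 * y) ≤ 1 / Real.log n := by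
    rw [div_le_div_iff₀ (by positivity) hlogn, hlogy]
    nlinarith
  refine hcore.trans ?_
  calc 2 * μ ^ 2 * (32 / Real.log n + 2 * K / (μ ^ 2 * y))
      ≤ 2 * μ ^ 2 * (32 / Real.log n + 1 / Real.log n) := by gcongr
    _ = 66 * μ ^ 2 / Real.log n := by field_simp; ring

/-! ### Under Kesten's bridge inequality with an explicit constant (`KestenIneqBridgesZ2 B`) -/

/-- The explicit upper two-step constant of `SAWBridgeTwoStepRateZ2.lean`: `K(B) = 10 μ √B + 37 B`.
[cite: MadrasSlade1993, Theorem 7.3.2(b) (quantitative form, derived)] -/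
private theorem twoStepK_nonneg {B : ℝ} (hB : 0 < B) :
    0 ≤ 10 * connectiveConstant 2 * Real.sqrt B + 37 * B := by
  have := connectiveConstant_pos 2
  positivity

/-- **R16-explicit on `ℤ²` (index form `b_n/b_{n-1}`).** Under Kesten's ratio inequality for bridges with
constant `B > 0` and every `n ≥ 1` (`KestenIneqBridgesZ2 B`), with `K = 10 μ √B + 37 B`: for every
`n ≥ 3^16` with `K^8 ≤ n`, `|b_n/b_{n-1} - μ| ≤ (64 μ² + 32 K)/log n`.
[cite: MadrasSlade1993, Theorem 7.3.4 (d) (quantitative form, derived)] -/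
theorem ratio_rate_explicit_Z2 {B : ℝ} (hB : 0 < B) (hKI : KestenIneqBridgesZ2 B) {n : ℕ}
    (hn : 3 ^ 16 ≤ n) (hKn : (10 * connectiveConstant 2 * Real.sqrt B + 37 * B) ^ 8 ≤ (n : ℝ)) :
    |(bridgeCount 2 n : ℝ) / bridgeCount 2 (n - 1) - connectiveConstant 2| ≤
      (64 * connectiveConstant 2 ^ 2 + 32 * (10 * connectiveConstant 2 * Real.sqrt B + 37 * B)) /
        Real.log n :=
  ratio_rate_explicit_of_twoStep_two (twoStepK_nonneg hB)
    (fun _ hN => twoStep_upper_explicit_Z2 hB hKI hN) hn hKn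

/-- **R16-explicit on `ℤ²` (the lane's `b_{N+1}/b_N` form).** Under `KestenIneqBridgesZ2 B` (`B > 0`),
with `K = 10 μ √B + 37 B`: for every `N ≥ 3^16` with `K^8 ≤ N`,
`|b_{N+1}/b_N - μ| ≤ (64 μ² + 32 K)/log N`.
[cite: MadrasSlade1993, Theorem 7.3.4 (d) (quantitative form, derived)] -/
theorem bridgeRatio_rate_explicit_Z2 {B : ℝ} (hB : 0 < B) (hKI : KestenIneqBridgesZ2 B) {N : ℕ}
    (hN : 3 ^ 16 ≤ N) (hKN : (10 * connectiveConstant 2 * Real.sqrt B + 37 * B) ^ 8 ≤ (N : ℝ)) :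
    |(bridgeCount 2 (N + 1) : ℝ) / bridgeCount 2 N - connectiveConstant 2| ≤
      (64 * connectiveConstant 2 ^ 2 + 32 * (10 * connectiveConstant 2 * Real.sqrt B + 37 * B)) /
        Real.log N := by
  have hKnn := twoStepK_nonneg hB
  have hN1 : 3 ^ 16 ≤ N + 1 := by omega
  have hKN1 : (10 * connectiveConstant 2 * Real.sqrt B + 37 * B) ^ 8 ≤ ((N + 1 : ℕ) : ℝ) :=
    hKN.trans (by exact_mod_cast Nat.le_succ N)
  have h := ratio_rate_explicit_Z2 hB hKI hN1 hKN1
  rw [Nat.add_sub_cancel] at h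
  have hN2 : 2 ≤ N := le_trans (by norm_num) hN
  have hlogN : 0 < Real.log N := Real.log_pos (by exact_mod_cast (show 1 < N by omega))
  have hlog_le : Real.log N ≤ Real.log ((N + 1 : ℕ) : ℝ) :=
    Real.log_le_log (by exact_mod_cast (show 0 < N by omega)) (by exact_mod_cast Nat.le_succ N)
  have hC : 0 ≤ 64 * connectiveConstant 2 ^ 2 + 32 * (10 * connectiveConstant 2 * Real.sqrt B + 37 * B) := by
    positivity
  exact h.trans (div_le_div_of_nonneg_left hC hlogN hlog_le)

/-- **Numeric packaging (`B ≥ 1`).** Under `KestenIneqBridgesZ2 B` with `B ≥ 1`: for every `N` with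
`(67 B)^8 ≤ N`, `|b_{N+1}/b_N - μ| ≤ 2720 B/log N` (using `2 ≤ μ ≤ 3`: `K ≤ 67 B`, `64 μ² ≤ 576 B`).
[cite: MadrasSlade1993, Theorem 7.3.4 (d) (quantitative form, derived)] -/
theorem bridgeRatio_rate_explicit_Z2_numeric {B : ℝ} (hB : 1 ≤ B) (hKI : KestenIneqBridgesZ2 B) {N : ℕ}
    (hN : (67 * B) ^ 8 ≤ (N : ℝ)) :
    |(bridgeCount 2 (N + 1) : ℝ) / bridgeCount 2 N - connectiveConstant 2| ≤ 2720 * B / Real.log N := by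
  set μ := connectiveConstant 2 with hμdef
  obtain ⟨hμ2, hμ3⟩ := two_le_mu_two_le_three
  have hB0 : 0 < B := by linarith
  have hsB : Real.sqrt B ≤ B := by
    calc Real.sqrt B ≤ Real.sqrt (B ^ 2) := Real.sqrt_le_sqrt (by nlinarith)
      _ = B := Real.sqrt_sq hB0.le
  have hsB0 : 0 ≤ Real.sqrt B := Real.sqrt_nonneg B
  have hK67 : 10 * μ * Real.sqrt B + 37 * B ≤ 67 * B := by nlinarith
  have hKnn : 0 ≤ 10 * μ * Real.sqrt B + 37 * B := twoStepK_nonneg hB0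
  have hKN : (10 * μ * Real.sqrt B + 37 * B) ^ 8 ≤ (N : ℝ) :=
    (pow_le_pow_left₀ hKnn hK67 8).trans hN
  have h67 : ((3 ^ 16 : ℕ) : ℝ) ≤ (67 * B) ^ 8 := by
    have h1 : (67 : ℝ) ≤ 67 * B := by nlinarith
    have h2 : (67 : ℝ) ^ 8 ≤ (67 * B) ^ 8 := pow_le_pow_left₀ (by norm_num) h1 8
    have h3 : ((3 ^ 16 : ℕ) : ℝ) ≤ (67 : ℝ) ^ 8 := by norm_num
    exact h3.trans h2
  have hN3 : 3 ^ 16 ≤ N := by exact_mod_cast h67.trans hN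
  have h := bridgeRatio_rate_explicit_Z2 hB0 hKI hN3 hKN
  have hN2 : 2 ≤ N := le_trans (by norm_num) hN3
  have hlogN : 0 < Real.log N := Real.log_pos (by exact_mod_cast (show 1 < N by omega))
  refine h.trans (div_le_div_of_nonneg_right ?_ hlogN.le)
  nlinarith

/-- **The lane's typed shape** (`stub_R16_explicit_Z2` of a-idea-1's Sketch_G5, verbatim body): under
`KestenIneqBridgesZ2 B` there are `K, N₀` with `|b_{N+1}/b_N - μ| ≤ K/log N` for all `N ≥ N₀`; here
WITNESSED by the closed forms `K = 64 μ² + 32(10 μ √B + 37 B)`, `N₀ = max(3^16, ⌈(10 μ √B + 37 B)^8⌉)`.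
[cite: MadrasSlade1993, Theorem 7.3.4 (d) (quantitative form, derived)] -/
theorem exists_bridgeRatio_rate_Z2 {B : ℝ} (hB : 0 < B) (hKI : KestenIneqBridgesZ2 B) :
    ∃ K : ℝ, ∃ N₀ : ℕ, ∀ N : ℕ, N₀ ≤ N →
      |(bridgeCount 2 (N + 1) : ℝ) / bridgeCount 2 N - connectiveConstant 2| ≤ K / Real.log N := by
  refine ⟨64 * connectiveConstant 2 ^ 2 + 32 * (10 * connectiveConstant 2 * Real.sqrt B + 37 * B),
    max (3 ^ 16) ⌈(10 * connectiveConstant 2 * Real.sqrt B + 37 * B) ^ 8⌉₊, fun N hN => ?_⟩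
  have hN1 : 3 ^ 16 ≤ N := le_trans (le_max_left _ _) hN
  have hN2 : ⌈(10 * connectiveConstant 2 * Real.sqrt B + 37 * B) ^ 8⌉₊ ≤ N := le_trans (le_max_right _ _) hN
  have hKN : (10 * connectiveConstant 2 * Real.sqrt B + 37 * B) ^ 8 ≤ (N : ℝ) :=
    (Nat.le_ceil _).trans (by exact_mod_cast hN2)
  exact bridgeRatio_rate_explicit_Z2 hB hKI hN1 hKN

end Literature.Probability.RandomPlanarGeometry.SAW.Zd

end
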